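import Summits.RiemannHypothesis.RiemannHypothesis.Theorems.UniversalFactorLehmerCheckerDefs

/-!
# RiemannHypothesis / UniversalFactor — `MediumKernelNoGo`, high window: the t-side checker (definitions)

Route `RiemannHypothesis/UniversalFactor`, crux `MediumKernelNoGo` (stmt-RiemannHypothesis-2577), line
`one-sided-average-sign-test`, registered stub `stub_highWindow` (`3/2 ≤ a ≤ 32`).  For every `a` in a
box `[A₁/AD, A₂/AD]` the line certifies the Laguerre dip certificate
`H_0(x₀) < 0 < P_a(x₀), Q_a(x₀)` at `x₀ = 2t₀`, `t₀ = 7005.08` (Lehmer's pair), where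
`P_a(x₀) = ∫₀^∞ H_0(x₀ − y) e^{−ay} dy = 2 ∫_{t<t₀} H_0(2t) e^{2a(t−t₀)} dt` and `Q_a` likewise.  The
`t`-integrals are cut into Gauss–Legendre cells of half-width `1/ρD` centred at `t₀ ∓ (2c+1)/ρD`
(`c < Cy`); on a cell the integrand is `−K₀ · Re F_κ(½+it)` up to `10⁻⁶` (`F_κ = lehmerF t₀ κ`,
`κ = ∓2a`, the sibling engine of `LehmerPointNoGo`, files `UniversalFactorLehmer*.lean`), and
`Re F_κ(½+it_j) = e^{−κ(t_j−t₀)} Re F_0(½+it_j)`: the node values `Re F_0(½+it_j)` (boxes of the certified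
`ζ` evaluator, `lehmerFBox … 0`) are computed ONCE (`hiPointData`) and each `a`-box only re-weights them
with the interval weights `e^{−2a d_j} ∈ [e^{−2a₂ d_j}, e^{−2a₁ d_j}]`, `d_j = |t_j − t₀|` (`hiSideSum`),
adds the quadrature/Stirling error of every cell maximised over the box (`hiSideErr`, constants of
`stub_highCell`) and the tails beyond the cells (`hiTails`, constants of `stub_highTailP/Q`), all in
`K₀`-free units, and tests `2·(sum + errors) + tail < 0` on both sides plus `Re F_0(½+it₀) > 0`
(`hCheck`).  DEFINITIONS only; soundness is proved in `UniversalFactorMediumHigh*.lean`.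

References: D. H. Lehmer, Acta Math. 95 (1956); G. Csordas, W. Smith, R. S. Varga, Constr. Approx. 10
(1994) (Lehmer pairs and the de Bruijn–Newman constant); N. G. de Bruijn, Duke Math. J. 17 (1950).
-/

set_option linter.dupNamespace false

namespace Summit.RiemannHypothesis.RiemannHypothesis.Theorems

open Complex Real Finset
open Literature.NumberTheory.LFunctions Literature.NumberTheory.LFunctions.ZetaNumerics
open Literature.Analysis.ValidatedNumerics Literature.Analysis.ValidatedNumerics.NumericsMP

/-! ## The cell rule scaled to half-width `1/ρD` -/

/-- Halvings for the exponentials of the high-window certificate (`|x| ≤ 1024`). [folklore] -/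
def UniversalFactor.hiKexp : ℕ := 10

/-- Nodes `u_j = glNodes[j]/(ρD·10³⁶) ∈ [−1/ρD, 1/ρD]`, as reals. [folklore] -/
noncomputable def UniversalFactor.hiU (ρD j : ℕ) : ℝ :=
  ((UniversalFactor.glNodes.getD j 0 : ℤ) : ℝ) / ((ρD : ℝ) * UniversalFactor.glScale)

/-- Weights `W_j = glWeights[j]/(ρD·10³⁶)`, as reals. [folklore] -/
noncomputable def UniversalFactor.hiWt (ρD j : ℕ) : ℝ :=
  ((UniversalFactor.glWeights.getD j 0 : ℤ) : ℝ) / ((ρD : ℝ) * UniversalFactor.glScale)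

/-- The nodes as rationals. [folklore] -/
def UniversalFactor.hiUQ (ρD j : ℕ) : ℚ :=
  ((UniversalFactor.glNodes.getD j 0 : ℤ) : ℚ) / ((ρD : ℚ) * UniversalFactor.glScale)

/-- The weights as rationals. [folklore] -/
def UniversalFactor.hiWQ (ρD j : ℕ) : ℚ :=
  ((UniversalFactor.glWeights.getD j 0 : ℤ) : ℚ) / ((ρD : ℚ) * UniversalFactor.glScale)

/-- The exactness defect `quadDefect (range 16) u W (1/ρD) (1/4) 31` of the scaled rule, in `ℚ`.
[folklore] -/
def UniversalFactor.hiDefectQ (ρD : ℕ) : ℚ :=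
  ∑ n ∈ Finset.range 32,
      |(((1 : ℚ) / ρD) ^ (n + 1) - (-((1 : ℚ) / ρD)) ^ (n + 1)) / (n + 1) -
        ∑ j ∈ Finset.range 16, UniversalFactor.hiWQ ρD j * UniversalFactor.hiUQ ρD j ^ n| / ((1 : ℚ) / 4) ^ n +
    (2 * ((1 : ℚ) / ρD) + ∑ j ∈ Finset.range 16, |UniversalFactor.hiWQ ρD j|) *
      ((((1 : ℚ) / ρD) / ((1 : ℚ) / 4)) ^ 32 / (1 - ((1 : ℚ) / ρD) / ((1 : ℚ) / 4)))

/-! ## Cells and nodes -/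

/-- Numerator of the centre `T_c = t₀ ∓ (2c+1)/ρD` of cell `c` (`fwd = false`: backward, `−`;
`fwd = true`: forward, `+`), over `hiCellTd ρD = ρD · t0D`. [folklore] -/
def UniversalFactor.hiCellTn (ρD : ℕ) (fwd : Bool) (c : ℕ) : ℤ :=
  if fwd then (ρD : ℤ) * UniversalFactor.lehmerT0N + (2 * c + 1) * UniversalFactor.lehmerT0D
  else (ρD : ℤ) * UniversalFactor.lehmerT0N - (2 * c + 1) * UniversalFactor.lehmerT0D

/-- Denominator of the centres. [folklore] -/
def UniversalFactor.hiCellTd (ρD : ℕ) : ℕ := ρD * UniversalFactor.lehmerT0D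

/-- Numerator of the node ordinate `t_{cj} = T_c + u_j`, over `hiNodeB ρD`. [folklore] -/
def UniversalFactor.hiNodeA (ρD : ℕ) (fwd : Bool) (c j : ℕ) : ℤ :=
  UniversalFactor.hiCellTn ρD fwd c * UniversalFactor.glScale +
    UniversalFactor.glNodes.getD j 0 * UniversalFactor.lehmerT0D

/-- Denominator of the node ordinates. [folklore] -/
def UniversalFactor.hiNodeB (ρD : ℕ) : ℕ := ρD * UniversalFactor.lehmerT0D * UniversalFactor.glScale

/-- The real centre of cell `c`. [folklore] -/
noncomputable def UniversalFactor.hiCellT (ρD : ℕ) (fwd : Bool) (c : ℕ) : ℝ :=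
  ((UniversalFactor.hiCellTn ρD fwd c : ℤ) : ℝ) / (UniversalFactor.hiCellTd ρD : ℝ)

/-! ## Point data (computed once) -/

/-- Data of one cell: the boxes `∋ Re F_0(½ + it_{cj})` of its 16 nodes, `∋ log T_c`, and
`∋ Re F(¼+iT_c/2) − Re F(¼+it₀/2)` (`F = stirlingPrim`). [folklore] -/
structure UniversalFactor.HiCell where
  /-- `∋ Re F_0(½ + it_{cj})`, `j < 16` -/
  res : List MI
  /-- `∋ log T_c` -/
  logT : MI
  /-- `∋ Re (F(¼+iT_c/2) − F(¼+it₀/2))` -/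
  d0 : MI

/-- The empty cell (default value for list access). [folklore] -/
def UniversalFactor.hiCell0 : UniversalFactor.HiCell := ⟨[], ⟨0, 0⟩, ⟨0, 0⟩⟩

/-- The box of `Re F_0(½ + it_{cj})`. [folklore] -/
def UniversalFactor.hiNodeRe (C : UniversalFactor.LCtx) (ρD : ℕ) (fwd : Bool) (c j : ℕ) : Option MI :=
  let a := UniversalFactor.hiNodeA ρD fwd c j
  if (UniversalFactor.hiNodeB ρD : ℤ) ≤ a then
    match UniversalFactor.lehmerFBox C a.toNat (UniversalFactor.hiNodeB ρD) 0 with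
    | some F => some F.re
    | none => none
  else none

/-- The boxes of the first `n` nodes of a cell. [folklore] -/
def UniversalFactor.hiNodeRes (C : UniversalFactor.LCtx) (ρD : ℕ) (fwd : Bool) (c : ℕ) : ℕ → Option (List MI)
  | 0 => some []
  | j + 1 =>
    match UniversalFactor.hiNodeRes C ρD fwd c j, UniversalFactor.hiNodeRe C ρD fwd c j with
    | some L, some r => some (L ++ [r])
    | _, _ => none

/-- The data of cell `c`. [folklore] -/
def UniversalFactor.hiCellData (C : UniversalFactor.LCtx) (ρD : ℕ) (fwd : Bool) (c : ℕ) :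
    Option UniversalFactor.HiCell :=
  let S := C.T.S
  let Tn := (UniversalFactor.hiCellTn ρD fwd c).toNat
  match UniversalFactor.hiNodeRes C ρD fwd c 16, UniversalFactor.spOf S C.Klog C.T.piI Tn (UniversalFactor.hiCellTd ρD),
    MI.logNat S C.Klog Tn, MI.logNat S C.Klog (UniversalFactor.hiCellTd ρD) with
  | some L, some P, some LN, some LD => some ⟨L, LN.sub LD, P.1.sub C.reSP0⟩
  | _, _, _, _ => none

/-- The data of the first `n` cells of a side. [folklore] -/
def UniversalFactor.hiSideData (C : UniversalFactor.LCtx) (ρD : ℕ) (fwd : Bool) : ℕ → Option (List UniversalFactor.HiCell)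
  | 0 => some []
  | c + 1 =>
    match UniversalFactor.hiSideData C ρD fwd c, UniversalFactor.hiCellData C ρD fwd c with
    | some L, some d => some (L ++ [d])
    | _, _ => none

/-- The data of the certificate point: half-width denominator, backward and forward cells, and the
sign check `Re F_0(½ + it₀) > 0` (`hCheck`). [folklore] -/
structure UniversalFactor.HiPoint where
  /-- half-width denominator `ρD` -/
  ρD : ℕ
  /-- backward cells `c < CyB` -/
  bwd : List UniversalFactor.HiCell
  /-- forward cells `c < CyF` -/
  fwd : List UniversalFactor.HiCell
  /-- `hCheck` -/
  h0 : Bool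

/-- Compute the point data. [folklore] -/
def UniversalFactor.hiPointData (C : UniversalFactor.LCtx) (ρD CyB CyF : ℕ) : Option UniversalFactor.HiPoint :=
  match UniversalFactor.hiSideData C ρD false CyB, UniversalFactor.hiSideData C ρD true CyF with
  | some B, some F => some ⟨ρD, B, F, UniversalFactor.hCheck C⟩
  | _, _ => none

/-! ## One `a`-box `[A₁/AD, A₂/AD]` -/

/-- Exponentials of a list of intervals (`none` if any is out of range). [folklore] -/
def UniversalFactor.hiExps (S : ℕ) : List MI → Option (List MI)
  | [] => some []
  | x :: xs =>
    match MI.exp S UniversalFactor.KEXP UniversalFactor.hiKexp x, UniversalFactor.hiExps S xs with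
    | some e, some es => some (e :: es)
    | _, _ => none

/-- The cell exponents `−2a(2c+1)/ρD`, `c < Cy`, at `a = A/AD`. [folklore] -/
def UniversalFactor.hiCellArgs (S A AD ρD Cy : ℕ) : List MI :=
  (List.range Cy).map fun c : ℕ => MI.ofFrac S (-(2 * (A : ℤ) * (2 * (c : ℤ) + 1))) (ρD * AD)

/-- The node exponents `±2a u_j` (`+` backward, `−` forward), `j < 16`, at `a = A/AD`. [folklore] -/
def UniversalFactor.hiNodeArgs (S A AD ρD : ℕ) (fwd : Bool) : List MI :=
  (List.range 16).map fun j : ℕ =>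
    MI.ofFrac S ((if fwd then -1 else 1) * (2 * (A : ℤ) * UniversalFactor.glNodes.getD j 0)) (AD * ρD * UniversalFactor.glScale)

/-- The interval-weighted sum of the first `n` nodes of one cell:
`Σ_j W_j · [e^{−2a₂d_j}, e^{−2a₁d_j}] · Re F_0(½+it_{cj})` (`Ec_k ∋ e^{−2a_k(2c+1)/ρD}`,
`En_k[j] ∋ e^{±2a_k u_j}`). [folklore] -/
def UniversalFactor.hiCellSum (S ρD : ℕ) (res En1 En2 : List MI) (Ec1 Ec2 : MI) : ℕ → MI
  | 0 => ⟨0, 0⟩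
  | j + 1 =>
    let w1 := MI.mul S Ec1 (En1.getD j ⟨0, 0⟩)
    let w2 := MI.mul S Ec2 (En2.getD j ⟨0, 0⟩)
    (UniversalFactor.hiCellSum S ρD res En1 En2 Ec1 Ec2 j).add
      (MI.mul S (MI.mul S (MI.span w2 w1) (res.getD j ⟨0, 0⟩))
        (MI.ofFrac S (UniversalFactor.glWeights.getD j 0) (ρD * UniversalFactor.glScale)))

/-- The interval-weighted sum of the first `n` cells of a side. [folklore] -/
def UniversalFactor.hiSideSum (S ρD : ℕ) (cells : List UniversalFactor.HiCell) (En1 En2 Ec1 Ec2 : List MI) : ℕ → MI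
  | 0 => ⟨0, 0⟩
  | c + 1 =>
    (UniversalFactor.hiSideSum S ρD cells En1 En2 Ec1 Ec2 c).add
      (UniversalFactor.hiCellSum S ρD (cells.getD c UniversalFactor.hiCell0).res En1 En2
        (Ec1.getD c ⟨0, 0⟩) (Ec2.getD c ⟨0, 0⟩) 16)

/-- Upper bound (exact rational, `K₀`-free units) of the quadrature + Stirling error of cell `c` over the
box: `5(T_c+1)³ e^{¼ + (log T_c+3)/8 + D₀ + 2a*(¼ − (2c+1)/ρD)} · hiDefectQ + (2/ρD)·10⁻⁶·25.3(T_c+1)²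
e^{(log T_c+3)/(2ρD) + D₀ − 4a₁c/ρD}` with `a* = a₂` if `ρD ≥ 4(2c+1)` else `a₁`. [folklore] -/
def UniversalFactor.hiCellErr (S ρD : ℕ) (fwd : Bool) (A₁ A₂ AD c : ℕ) (cell : UniversalFactor.HiCell) : Option ℚ :=
  let coefN : ℤ := (ρD : ℤ) - 4 * (2 * (c : ℤ) + 1)
  let Astar : ℕ := if 0 ≤ coefN then A₂ else A₁
  let L3 := cell.logT.add (MI.ofInt S 3)
  let XD := (((MI.ofFrac S 1 4).add (L3.divNat 8)).add cell.d0).add (MI.ofFrac S (2 * (Astar : ℤ) * coefN) (4 * ρD * AD))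
  let XS := ((L3.divNat (2 * ρD)).add cell.d0).add (MI.ofFrac S (-(4 * (A₁ : ℤ) * c)) (ρD * AD))
  match MI.exp S UniversalFactor.KEXP UniversalFactor.hiKexp XD, MI.exp S UniversalFactor.KEXP UniversalFactor.hiKexp XS with
  | some ED, some ES =>
    let T1 : ℚ := ((UniversalFactor.hiCellTn ρD fwd c : ℚ) + UniversalFactor.hiCellTd ρD) / UniversalFactor.hiCellTd ρD
    some (5 * T1 ^ 3 * ((ED.hi : ℚ) / S) * UniversalFactor.hiDefectQ ρD +
      2 * ((1 : ℚ) / ρD) * (1 / 10 ^ 6) * (253 / 10 * T1 ^ 2 * ((ES.hi : ℚ) / S)))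
  | _, _ => none

/-- Sum of the error bounds of the first `n` cells of a side. [folklore] -/
def UniversalFactor.hiSideErr (S ρD : ℕ) (fwd : Bool) (A₁ A₂ AD : ℕ) (cells : List UniversalFactor.HiCell) : ℕ → Option ℚ
  | 0 => some 0
  | c + 1 =>
    match UniversalFactor.hiSideErr S ρD fwd A₁ A₂ AD cells c,
      UniversalFactor.hiCellErr S ρD fwd A₁ A₂ AD c (cells.getD c UniversalFactor.hiCell0) with
    | some e, some x => some (e + x)
    | _, _ => none

/-- Upper bounds (exact rationals, `K₀`-free units) of the two tails at `a = a₁`: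
`C(t₀)(t₀+1)³ e^{−(a₁−π/8)Y_b}/(a₁−π/8) + 1` (`Y_b = 4CyB/ρD`) and `C(t₀)(t₀+1)³ e^{−a₁Y_f}/a₁`
(`Y_f = 4CyF/ρD`), `C(t₀) = lehmerTailConst t₀`. [folklore] -/
def UniversalFactor.hiTails (C : UniversalFactor.LCtx) (ρD CyB CyF A₁ AD : ℕ) : Option (ℚ × ℚ) :=
  let S := C.T.S
  match MI.logNat S C.Klog UniversalFactor.lehmerT0N, MI.logNat S C.Klog (2 * UniversalFactor.lehmerT0D) with
  | some LN, some LD =>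
    let ex := (((LN.sub LD).divNat 4).add (MI.ofFrac S 67 64)).add (C.T.piI.divNat 4)
    match MI.exp S UniversalFactor.KEXP UniversalFactor.kEXP ex with
    | some EC =>
      let Acst := MI.mul S (EC.mulInt 5)
        (MI.ofFrac S (((UniversalFactor.lehmerT0N + UniversalFactor.lehmerT0D) ^ 3 : ℕ) : ℤ) (UniversalFactor.lehmerT0D ^ 3))
      let r := (MI.ofFrac S (A₁ : ℤ) AD).sub (C.T.piI.divNat 8)
      match MI.exp S UniversalFactor.KEXP UniversalFactor.hiKexp
          ((MI.ofFrac S (-(4 * (CyB : ℤ) * A₁)) (ρD * AD)).add ((C.T.piI.mulInt (CyB : ℤ)).divNat (2 * ρD))),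
        MI.exp S UniversalFactor.KEXP UniversalFactor.hiKexp (MI.ofFrac S (-(4 * (CyF : ℤ) * A₁)) (ρD * AD)) with
      | some E1, some E2 =>
        match MI.divPos S (MI.mul S Acst E1) r with
        | some Q1 => some (((Q1.hi : ℚ) / S) + 1, ((MI.mul S Acst E2).hi : ℚ) / S * AD / A₁)
        | none => none
      | _, _ => none
    | none => none
  | _, _ => none

/-- The weight tables of a box: exponentials of the cell and node exponents at both endpoints, both
sides. [folklore] -/
def UniversalFactor.hiBoxTabs (S ρD CyB CyF A₁ A₂ AD : ℕ) :
    Option ((List MI × List MI × List MI × List MI) × (List MI × List MI × List MI × List MI)) :=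
  match UniversalFactor.hiExps S (UniversalFactor.hiCellArgs S A₁ AD ρD CyB),
    UniversalFactor.hiExps S (UniversalFactor.hiCellArgs S A₂ AD ρD CyB),
    UniversalFactor.hiExps S (UniversalFactor.hiNodeArgs S A₁ AD ρD false),
    UniversalFactor.hiExps S (UniversalFactor.hiNodeArgs S A₂ AD ρD false) with
  | some EcB1, some EcB2, some EnB1, some EnB2 =>
    match UniversalFactor.hiExps S (UniversalFactor.hiCellArgs S A₁ AD ρD CyF),
      UniversalFactor.hiExps S (UniversalFactor.hiCellArgs S A₂ AD ρD CyF),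
      UniversalFactor.hiExps S (UniversalFactor.hiNodeArgs S A₁ AD ρD true),
      UniversalFactor.hiExps S (UniversalFactor.hiNodeArgs S A₂ AD ρD true) with
    | some EcF1, some EcF2, some EnF1, some EnF2 => some ((EcB1, EcB2, EnB1, EnB2), (EcF1, EcF2, EnF1, EnF2))
    | _, _, _, _ => none
  | _, _, _, _ => none

/-- **The box check**: with `sP, sQ` the interval-weighted sums, `eP, eQ` the cell errors and `tP, tQ`
the tails, test `sP.hi/S + eP + tP/2 < 0`, `sQ.hi/S + eQ + tQ/2 < 0` and `hCheck`. [folklore] -/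
def UniversalFactor.hiBoxCheck (C : UniversalFactor.LCtx) (pt : UniversalFactor.HiPoint) (CyB CyF A₁ A₂ AD : ℕ) : Bool :=
  let S := C.T.S
  match UniversalFactor.hiBoxTabs S pt.ρD CyB CyF A₁ A₂ AD,
    UniversalFactor.hiSideErr S pt.ρD false A₁ A₂ AD pt.bwd CyB,
    UniversalFactor.hiSideErr S pt.ρD true A₁ A₂ AD pt.fwd CyF,
    UniversalFactor.hiTails C pt.ρD CyB CyF A₁ AD with
  | some ((EcB1, EcB2, EnB1, EnB2), (EcF1, EcF2, EnF1, EnF2)), some eP, some eQ, some (tP, tQ) =>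
    let sP := UniversalFactor.hiSideSum S pt.ρD pt.bwd EnB1 EnB2 EcB1 EcB2 CyB
    let sQ := UniversalFactor.hiSideSum S pt.ρD pt.fwd EnF1 EnF2 EcF1 EcF2 CyF
    decide ((sP.hi : ℚ) / S + eP + tP / 2 < 0) && decide ((sQ.hi : ℚ) / S + eQ + tQ / 2 < 0) && pt.h0
  | _, _, _, _ => false

/-- **The cover check** of consecutive boxes `[As[k], As[k+1]]/AD` (with the static guards `ρD ≥ 8`,
`(2Cy − 1)/ρD ≤ 10`, `AD > 0`, `≥ 2` breakpoints, `a₁ ≥ 1`). [folklore] -/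
def UniversalFactor.hiCoverCheck (C : UniversalFactor.LCtx) (pt : UniversalFactor.HiPoint) (CyB CyF : ℕ) (As : List ℕ) (AD : ℕ) : Bool :=
  decide (8 ≤ pt.ρD ∧ 2 * CyB ≤ 10 * pt.ρD + 1 ∧ 2 * CyF ≤ 10 * pt.ρD + 1 ∧ 0 < AD ∧ 2 ≤ As.length) &&
  (List.range (As.length - 1)).all fun k =>
    decide (AD ≤ As.getD k 0) && UniversalFactor.hiBoxCheck C pt CyB CyF (As.getD k 0) (As.getD (k + 1) 0) AD

/-- The whole window check from optional tables (the parametrised form keeps the kernel from ever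
evaluating the tables). [folklore] -/
def UniversalFactor.hiRunWith (oT : Option Tables) (ρD CyB CyF : ℕ) (As : List ℕ) (AD : ℕ) : Bool :=
  match oT with
  | none => false
  | some T =>
    match UniversalFactor.mkCtx T 140 UniversalFactor.lehmerT0N UniversalFactor.lehmerT0D with
    | none => false
    | some C =>
      match UniversalFactor.hiPointData C ρD CyB CyF with
      | none => false
      | some pt => UniversalFactor.hiCoverCheck C pt CyB CyF As AD

/-- **The window check**: tables `lehmerTables` (`S = 2¹⁰⁰`, `N = 1700`), cells of half-width `1/ρD`,
`CyB` backward and `CyF` forward cells, boxes `As/AD`. [folklore] -/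
def UniversalFactor.hiRun (ρD CyB CyF : ℕ) (As : List ℕ) (AD : ℕ) : Bool :=
  UniversalFactor.hiRunWith UniversalFactor.lehmerTables ρD CyB CyF As AD

/-- **Registered anchor `stub_hiDefs`** of this definitions file (trivial identities pinning the data).
[folklore] -/
theorem UniversalFactor.stub_hiDefs : UniversalFactor.hiKexp = 10 ∧ UniversalFactor.hiCell0.res = [] := ⟨rfl, rfl⟩

end Summit.RiemannHypothesis.RiemannHypothesis.Theorems
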